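import Summits.BirchSwinnertonDyer.BirchSwinnertonDyer.Theorems.GoldfeldAllTwistsTwoConverseTwinGenusDescentPartnerNegTwo
import HarnessLib

set_option linter.dupNamespace false -- `…BirchSwinnertonDyer.BirchSwinnertonDyer…` is the cell's namespace (D-0017)
set_option autoImplicit false

/-!
# LINE B49 — the FIXED partner curves, XII: `c₂(W₃₁₃₆) = 4` EXACTLY, `Tam(W₃₁₃₆) = 8`, and
# «BSD₂(3136⁻) exact» by name for the F2 partner `W₃₁₃₆ = [0, −42, 0, 448, 0]` (part 2 of 2)

Cell `bsd-goldfeld`, seat `bsd-goldfeld-s1p-c301` (prover, gen 8); TARGET v5.8 §2 c301 order (2) (the `3136⁻`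
analogue of files IX/X for seat c3's family F2, `d_K = −8q`, of the genus mechanism); support for item
`stmt-BirchSwinnertonDyer-19140` (twin″; joint with 20044). HONEST FRAMING: kernel theorems about the explicit
global minimal model `W₃₁₃₆ = [0, −42, 0, 448, 0]` of `49a1^{(−2)}`; the last theorem takes bsd.S31
(`bsdTriple_of_rank_le_one_of_conductor_lt`) and Modularity as NAMED binders; BSD is not proved by any of
this. Not in the Theses cone.

WHAT IS PROVED. File XI left `c₂ ∈ {2, 4}` (type `I₈*`). Here, exactly as in file X for `784`: on
`J = W₃₁₃₆ ⊗ ℤ₂` — itself an `Iₙ*` normal form (`a₁ ∈ 𝔪`, `a₂ = −42 ∈ 𝔪 ∖ 𝔪²`, `a₃ ∈ 𝔪²`,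
`a₄ = 2⁶·7 ∈ 𝔪³`, `a₆ ∈ 𝔪⁴`), no translation needed — the points `T = (0, 0)`, `g = (32, 64)` and
`g + T = (14, −28)` have both coordinates in `𝔪 = 2ℤ₂`, hence reduce to the singular point and lie OUTSIDE
`J₀(ℚ₂)` (`LocalIndex.not_hasNonsingularReduction_some`); index `2` would put `T`, `g`, `g + T` in the one
non-trivial coset, forcing it to contain `0`; with `LocalIndex.index_mem_of_normalForm_Istar_succ` the index
is `4`, and by `LocalIndex.localTamagawaNumber_eq_index_of_smul_eq_baseChange` (minimality of `J` at `2` =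
file III's Kraus test via `isMinimalAt_iff_isMinimal_padic`) **`c₂(W₃₁₃₆) = 4`**. Then
**`tamagawaProduct_W3136 : Tam(W₃₁₃₆) = c₂ · c₇ = 8`** (`tamagawaProduct_eq_prod` over the places `2, 7` of
`ℤ`, `Δ = −2¹⁸·7³`, `c₇ = 2` of file XI; the bridge `localTamagawaNumber_padic_eq_of_forall_place` is the
generic form of file IX's) and **`leadingLCoeff_W3136 (hS31) (hmod)`**: `L′(W₃₁₃₆, 1) = r · Ω(W₃₁₃₆) · ĥ(g₃₁₃₆)`,
`r = 2·#Ш/k² ∈ ℚ`, `v₂(r) = 1` — the C6 row of the F2 height-ratio chain, granted ONLY bsd.S31 + Modularity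
(rank `1`, `Ш[2] = 0`, `#Ш` odd, `#E(ℚ)_tors = 2`, `ĥ(g₃₁₃₆) = k²·Reg` with `k` odd, `N = 3136`: files
II/III/V/XI). Numerics (kit j269009): `c₂ = 4`, `Tam = 8`, `L′(1)/(Ω·ĥ((32,64))) = 2.0000000000`.
References: [Silverman1994] IV.9.4 Step 7 and Table 4.1; [SilvermanAEC2009] VII.1.3(b), VII.2.1, VII.6;
[CreutzMiller2012]; [CremonaAlgorithms1997] Table 1 (N = 3136: `c₂ = 4`, `c₇ = 2`).
-/

noncomputable section

open scoped Classical NumberField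

open WeierstrassCurve IsDedekindDomain IsLocalRing Rat.HeightOneSpectrum
  Literature.NumberTheory.EllipticCurves Literature.NumberTheory.EllipticCurves.ModularForms
  Summit.BirchSwinnertonDyer.BirchSwinnertonDyer.Rank2Observatory.Tate
  Summit.BirchSwinnertonDyer.BirchSwinnertonDyer.Rank2Observatory.RootNumber

namespace Summit.BirchSwinnertonDyer.BirchSwinnertonDyer.Theorems.GoldfeldGoodTwists

/-! ### Three rational points of `J = W₃₁₃₆ ⊗ ℤ₂` over `ℚ₂` -/

/-- `T = (0, 0) ∈ J(ℚ₂)`, `J = [0, −42, 0, 448, 0]` (the rational `2`-torsion point). [folklore] -/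
theorem nonsingular_J3136_zero_zero :
    ((⟨0, -42, 0, 448, 0⟩ : WeierstrassCurve ℤ_[2]).baseChange ℚ_[2]).toAffine.Nonsingular
      (algebraMap ℤ_[2] ℚ_[2] 0) (algebraMap ℤ_[2] ℚ_[2] 0) := by
  rw [Affine.nonsingular_iff', Affine.equation_iff']
  simp only [baseChange, toAffine, map_a₁, map_a₂, map_a₃, map_a₄, map_a₆, map_neg, map_ofNat, map_zero]
  norm_num

/-- `g = (32, 64) ∈ J(ℚ₂)`. [folklore] -/
theorem nonsingular_J3136_threeTwo_sixFour :
    ((⟨0, -42, 0, 448, 0⟩ : WeierstrassCurve ℤ_[2]).baseChange ℚ_[2]).toAffine.Nonsingular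
      (algebraMap ℤ_[2] ℚ_[2] 32) (algebraMap ℤ_[2] ℚ_[2] 64) := by
  rw [Affine.nonsingular_iff', Affine.equation_iff']
  simp only [baseChange, toAffine, map_a₁, map_a₂, map_a₃, map_a₄, map_a₆, map_neg, map_ofNat, map_zero]
  norm_num

/-- `g + T = (14, −28) ∈ J(ℚ₂)`. [folklore] -/
theorem nonsingular_J3136_fourteen_negTwoEight :
    ((⟨0, -42, 0, 448, 0⟩ : WeierstrassCurve ℤ_[2]).baseChange ℚ_[2]).toAffine.Nonsingular
      (algebraMap ℤ_[2] ℚ_[2] 14) (algebraMap ℤ_[2] ℚ_[2] (-28)) := by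
  rw [Affine.nonsingular_iff', Affine.equation_iff']
  simp only [baseChange, toAffine, map_a₁, map_a₂, map_a₃, map_a₄, map_a₆, map_neg, map_ofNat, map_zero]
  norm_num

/-- **`g + T = (14, −28)` in `J(ℚ₂)`** (slope `2`). [folklore] -/
theorem threeTwoSixFour_add_zeroZero_J3136 :
    (Affine.Point.some _ _ nonsingular_J3136_threeTwo_sixFour :
        ((⟨0, -42, 0, 448, 0⟩ : WeierstrassCurve ℤ_[2]).baseChange ℚ_[2]).toAffine.Point) +
      Affine.Point.some _ _ nonsingular_J3136_zero_zero =
      Affine.Point.some _ _ nonsingular_J3136_fourteen_negTwoEight := by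
  have hx : algebraMap ℤ_[2] ℚ_[2] 32 ≠ algebraMap ℤ_[2] ℚ_[2] 0 := by
    rw [map_ofNat, map_zero]; norm_num
  rw [Affine.Point.add_of_X_ne hx]
  refine point_some_congr ?_ ?_
  · rw [Affine.slope_of_X_ne hx]
    simp only [Affine.addX, baseChange, toAffine, map_a₁, map_a₂, map_neg, map_ofNat, map_zero]
    norm_num
  · rw [Affine.addY, Affine.negAddY, Affine.negY, Affine.slope_of_X_ne hx]
    simp only [Affine.addX, baseChange, toAffine, map_a₁, map_a₂, map_a₃, map_neg, map_ofNat, map_zero]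
    norm_num

/-! ### The index `[J(ℚ₂) : J₀(ℚ₂)] = 4` -/

/-- **`[J(ℚ₂) : J₀(ℚ₂)] = 4` for `J = [0, −42, 0, 448, 0]`** (an `Iₙ*` normal form: the index is `2` or `4`
by `LocalIndex.index_mem_of_normalForm_Istar_succ`; the points `T = (0,0)`, `g = (32,64)`, `g + T = (14,−28)`
reduce to the singular point, so index `2` would put `T`, `g`, `g + T` in the same non-trivial coset).
[cite: Silverman1994, IV.9.4 Step 7 and Table 4.1] -/
theorem index_nonsingularReductionSubgroup_J3136 :
    ((⟨0, -42, 0, 448, 0⟩ : WeierstrassCurve ℤ_[2]).nonsingularReductionSubgroup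
      (integers_valuationRing_valuation ℤ_[2] ℚ_[2])).index = 4 := by
  haveI : HenselianLocalRing ℤ_[2] :=
    { is_henselian := fun f hf a₀ h₁ h₂ =>
        HenselianRing.is_henselian (I := IsLocalRing.maximalIdeal ℤ_[2]) f hf a₀ h₁ (h₂.map _) }
  set H := (⟨0, -42, 0, 448, 0⟩ : WeierstrassCurve ℤ_[2]).nonsingularReductionSubgroup
    (integers_valuationRing_valuation ℤ_[2] ℚ_[2]) with hH
  have hΔ : (⟨0, -42, 0, 448, 0⟩ : WeierstrassCurve ℤ_[2]).Δ ≠ 0 := by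
    simp only [WeierstrassCurve.Δ, b₂, b₄, b₆, b₈]; norm_num
  have h1 : (⟨0, -42, 0, 448, 0⟩ : WeierstrassCurve ℤ_[2]).a₁ ∈ maximalIdeal ℤ_[2] := by simp
  have h2 : (⟨0, -42, 0, 448, 0⟩ : WeierstrassCurve ℤ_[2]).a₂ ∈ maximalIdeal ℤ_[2] := by
    have h := (intCast_mem_maximalIdeal_pow_padicInt_two_iff (-42) 1).mpr (by norm_num)
    rw [pow_one] at h; simpa using h
  have h2' : (⟨0, -42, 0, 448, 0⟩ : WeierstrassCurve ℤ_[2]).a₂ ∉ maximalIdeal ℤ_[2] ^ 2 := by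
    have h := (intCast_mem_maximalIdeal_pow_padicInt_two_iff (-42) 2).not.mpr (by norm_num)
    simpa using h
  have h3 : (⟨0, -42, 0, 448, 0⟩ : WeierstrassCurve ℤ_[2]).a₃ ∈ maximalIdeal ℤ_[2] ^ 2 := by simp
  have h4 : (⟨0, -42, 0, 448, 0⟩ : WeierstrassCurve ℤ_[2]).a₄ ∈ maximalIdeal ℤ_[2] ^ 3 := by
    have h := (intCast_mem_maximalIdeal_pow_padicInt_two_iff 448 3).mpr (by norm_num)
    simpa using h
  have h6 : (⟨0, -42, 0, 448, 0⟩ : WeierstrassCurve ℤ_[2]).a₆ ∈ maximalIdeal ℤ_[2] ^ 4 := by simp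
  rcases LocalIndex.index_mem_of_normalForm_Istar_succ (K := ℚ_[2]) _ hΔ h1 h2 h2' h3 h4 h6 with h | h
  swap
  · exact h
  exfalso
  -- the three bad points
  have h3₁ : (⟨0, -42, 0, 448, 0⟩ : WeierstrassCurve ℤ_[2]).a₃ ∈ maximalIdeal ℤ_[2] := by simp
  have h4₁ : (⟨0, -42, 0, 448, 0⟩ : WeierstrassCurve ℤ_[2]).a₄ ∈ maximalIdeal ℤ_[2] := by
    simpa using natCast_mem_maximalIdeal_padicInt_two (n := 448) (by norm_num)
  have h0 : (0 : ℤ_[2]) ∈ maximalIdeal ℤ_[2] := Ideal.zero_mem _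
  have h32 : (32 : ℤ_[2]) ∈ maximalIdeal ℤ_[2] := by
    simpa using natCast_mem_maximalIdeal_padicInt_two (n := 32) (by norm_num)
  have h64 : (64 : ℤ_[2]) ∈ maximalIdeal ℤ_[2] := by
    simpa using natCast_mem_maximalIdeal_padicInt_two (n := 64) (by norm_num)
  have h14 : (14 : ℤ_[2]) ∈ maximalIdeal ℤ_[2] := by
    simpa using natCast_mem_maximalIdeal_padicInt_two (n := 14) (by norm_num)
  have h28 : (-28 : ℤ_[2]) ∈ maximalIdeal ℤ_[2] := by
    have h := (intCast_mem_maximalIdeal_pow_padicInt_two_iff (-28) 1).mpr (by norm_num)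
    rw [pow_one] at h; simpa using h
  have hT : (Affine.Point.some _ _ nonsingular_J3136_zero_zero) ∉ H := fun hmem =>
    LocalIndex.not_hasNonsingularReduction_some _ h3₁ h4₁ h0 h0 nonsingular_J3136_zero_zero
      ((mem_nonsingularReductionSubgroup_iff _).mp hmem)
  have hg : (Affine.Point.some _ _ nonsingular_J3136_threeTwo_sixFour) ∉ H := fun hmem =>
    LocalIndex.not_hasNonsingularReduction_some _ h3₁ h4₁ h32 h64 nonsingular_J3136_threeTwo_sixFour
      ((mem_nonsingularReductionSubgroup_iff _).mp hmem)
  have hgT : (Affine.Point.some _ _ nonsingular_J3136_fourteen_negTwoEight) ∉ H := fun hmem =>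
    LocalIndex.not_hasNonsingularReduction_some _ h3₁ h4₁ h14 h28 nonsingular_J3136_fourteen_negTwoEight
      ((mem_nonsingularReductionSubgroup_iff _).mp hmem)
  -- index two: one non-trivial coset `· + a`
  obtain ⟨a, ha⟩ := AddSubgroup.index_eq_two_iff.mp h
  have key : ∀ P, P ∉ H → P + a ∈ H := fun P hP => by
    rcases ha P with ⟨h', -⟩ | ⟨h', -⟩
    · exact h'
    · exact (hP h').elim
  have ha' : a ∈ H := by
    have e : a = (Affine.Point.some _ _ nonsingular_J3136_threeTwo_sixFour + a) +
        (Affine.Point.some _ _ nonsingular_J3136_zero_zero + a) -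
        (Affine.Point.some _ _ nonsingular_J3136_fourteen_negTwoEight + a) := by
      rw [← threeTwoSixFour_add_zeroZero_J3136]; abel
    rw [e]
    exact H.sub_mem (H.add_mem (key _ hg) (key _ hT)) (key _ hgT)
  rcases ha 0 with ⟨-, h'⟩ | ⟨-, h'⟩
  · exact h' H.zero_mem
  · exact h' (by rwa [zero_add])

/-! ### `c₂(W₃₁₃₆) = 4` -/

/-- `W₃₁₃₆ ⊗ ℚ₂ = J ⊗ ℚ₂` along the identity change, `J = [0, −42, 0, 448, 0]` over `ℤ₂`. [folklore] -/
theorem smul_W3136_padic_two :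
    (1 : VariableChange ℚ_[2]) • ((⟨0, -42, 0, 448, 0⟩ : WeierstrassCurve ℚ).baseChange ℚ_[2]) =
      (⟨0, -42, 0, 448, 0⟩ : WeierstrassCurve ℤ_[2]).baseChange ℚ_[2] := by
  rw [one_smul]
  ext <;> simp only [baseChange, map_a₁, map_a₂, map_a₃, map_a₄, map_a₆, map_neg, map_ofNat, map_zero]

/-- `J ⊗ ℚ₂` is a MINIMAL equation over `ℤ₂` (file III's Kraus test at `2` for `W₃₁₃₆`, transported to
Mathlib's `ℚ₂`). [cite: Kraus1989, Thm 2 (p = 2)] -/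
theorem isMinimal_J3136_padic_two :
    ((⟨0, -42, 0, 448, 0⟩ : WeierstrassCurve ℤ_[2]).baseChange ℚ_[2]).IsMinimal ℤ_[2] := by
  set w₂ : HeightOneSpectrum (𝓞 ℚ) := (primesEquiv (R := 𝓞 ℚ)).symm ⟨2, Nat.prime_two⟩ with hw₂
  have h2 : ((primesEquiv w₂ : Nat.Primes) : ℕ) = 2 := by rw [hw₂, Equiv.apply_symm_apply]
  have hmin : ((⟨0, -42, 0, 448, 0⟩ : WeierstrassCurve ℤ).baseChange ℚ).IsMinimalAt w₂ := by
    rw [← twoTorsionModel_neg_two_eq_baseChange]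
    exact isGloballyMinimal_twoTorsionModel_neg_two.isMinimal w₂
  have hmin2 := (isMinimalAt_iff_isMinimal_padic w₂ 2 h2 _).mp hmin
  have e : ((⟨0, -42, 0, 448, 0⟩ : WeierstrassCurve ℤ).baseChange ℚ).baseChange ℚ_[2] =
      (⟨0, -42, 0, 448, 0⟩ : WeierstrassCurve ℤ_[2]).baseChange ℚ_[2] := by
    ext <;> simp only [baseChange, map_a₁, map_a₂, map_a₃, map_a₄, map_a₆, map_neg, map_ofNat, map_zero]
  rw [← e]
  exact hmin2

/-- **`c₂(W₃₁₃₆) = 4`** (Mathlib's `2`-adic numbers): the local Tamagawa number of `W₃₁₃₆ ⊗ ℚ₂` is the index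
`[J(ℚ₂) : J₀(ℚ₂)] = 4`. [cite: Silverman1994, IV.9.4 Step 7 and Table 4.1] [cite: CremonaAlgorithms1997, Table 1 (N = 3136)] -/
theorem localTamagawaNumber_padic_W3136_two :
    (haveI := isElliptic_twoTorsionModel_neg_two
     ((⟨0, -42, 0, 448, 0⟩ : WeierstrassCurve ℚ).baseChange ℚ_[2]).localTamagawaNumber ℤ_[2]) = 4 := by
  haveI := isElliptic_twoTorsionModel_neg_two
  haveI := isMinimal_J3136_padic_two
  rw [LocalIndex.localTamagawaNumber_eq_index_of_smul_eq_baseChange _ _ _ smul_W3136_padic_two]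
  exact index_nonsingularReductionSubgroup_J3136

/-- **`c₂(W₃₁₃₆) = 4` at the place of `𝓞 ℚ` above `2`** (bridged by `localTamagawaNumber_padic_eq_holds`).
[cite: Silverman1994, IV.9.4 Step 7 and Table 4.1] -/
theorem localTamagawaNumber_W3136_two_eq_four (w : HeightOneSpectrum (𝓞 ℚ)) (hw : natGenerator w = 2) :
    (haveI := isElliptic_twoTorsionModel_neg_two
     ((⟨0, -42, 0, 448, 0⟩ : WeierstrassCurve ℚ).baseChange (w.adicCompletion ℚ)).localTamagawaNumber
        (w.adicCompletionIntegers ℚ)) = 4 := by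
  haveI := isElliptic_twoTorsionModel_neg_two
  rw [← localTamagawaNumber_padic_eq_holds (⟨0, -42, 0, 448, 0⟩ : WeierstrassCurve ℚ) w 2 hw]
  exact localTamagawaNumber_padic_W3136_two

/-! ## §4 `Tam(W₃₁₃₆) = 8` and «BSD₂(3136⁻) exact» by name -/

/-- `Δ([0, −42, 0, 448, 0]) = −2¹⁸·7³`: a prime dividing it is `2` or `7`. [folklore] -/
theorem eq_two_or_seven_of_dvd_Δ_W3136 {p : ℕ} (hp : p.Prime)
    (h : (p : ℤ) ∣ (⟨0, -42, 0, 448, 0⟩ : WeierstrassCurve ℤ).Δ) : p = 2 ∨ p = 7 := by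
  rw [invariants_twoTorsionModel_neg_two.2.2, dvd_neg] at h
  have h' : p ∣ 2 ^ 18 * 7 ^ 3 := by exact_mod_cast h
  rcases (Nat.Prime.dvd_mul hp).mp h' with h2 | h7
  · exact Or.inl ((Nat.prime_dvd_prime_iff_eq hp Nat.prime_two).mp (hp.dvd_of_dvd_pow h2))
  · exact Or.inr ((Nat.prime_dvd_prime_iff_eq hp (by norm_num)).mp (hp.dvd_of_dvd_pow h7))

/-- The `p`-adic local Tamagawa number of an elliptic curve `W/ℚ` at a place `v` of `ℤ`, computed from its
value at the places of `𝓞 ℚ` above `p` (the factor of `tamagawaProduct_eq_prod`; generic form of file IX's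
`localTamagawaNumber_padic_W784_eq`). [folklore] -/
theorem localTamagawaNumber_padic_eq_of_forall_place (W : WeierstrassCurve ℚ) [W.IsElliptic]
    (v : HeightOneSpectrum ℤ) (p : ℕ) [hp : Fact p.Prime] (hv : (primesEquiv v : ℕ) = p) (c : ℕ)
    (hc : ∀ w : HeightOneSpectrum (𝓞 ℚ), natGenerator w = p →
      (W.baseChange (w.adicCompletion ℚ)).localTamagawaNumber (w.adicCompletionIntegers ℚ) = c) :
    (haveI := Fact.mk (primesEquiv v).2
     (W.baseChange ℚ_[primesEquiv v]).localTamagawaNumber ℤ_[primesEquiv v]) = c := by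
  -- replace the dependent prime `primesEquiv v` by `p`
  obtain ⟨q, hq⟩ : ∃ q : Nat.Primes, primesEquiv v = q := ⟨_, rfl⟩
  have hqp : (q : ℕ) = p := by rw [← hq]; exact hv
  rw [hq]
  obtain ⟨q, hq'⟩ := q
  simp only at hqp
  subst hqp
  -- the place of `𝓞 ℚ` above `p`
  set w : HeightOneSpectrum (𝓞 ℚ) := (primesEquiv (R := 𝓞 ℚ)).symm ⟨q, hq'⟩ with hw
  have hwq : (primesEquiv w : ℕ) = q := by rw [hw, Equiv.apply_symm_apply]
  have key := localTamagawaNumber_padic_eq_holds W w q hwq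
  have hgen : natGenerator w = q := by
    rw [hw]; exact Literature.NumberTheory.GaloisRepresentations.Rat.natGenerator_primesEquiv_symm ⟨q, hq'⟩
  have e : (Fact.mk hq' : Fact (Nat.Prime q)) = hp := Subsingleton.elim _ _
  subst e
  rw [key]
  exact hc w hgen

/-- **`Tam(W₃₁₃₆) = c₂ · c₇ = 4 · 2 = 8` IN THE KERNEL** (bad places `2, 7` of `Δ = −2¹⁸·7³`; product formula
`tamagawaProduct_eq_prod`). [cite: Silverman1994, IV.9.4 and Table 4.1] [cite: CremonaAlgorithms1997, Table 1 (N = 3136)] -/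
theorem tamagawaProduct_W3136 : (⟨0, -42, 0, 448, 0⟩ : WeierstrassCurve ℚ).tamagawaProduct = 8 := by
  haveI := isElliptic_twoTorsionModel_neg_two
  set v₂ : HeightOneSpectrum ℤ := (primesEquiv (R := ℤ)).symm ⟨2, Nat.prime_two⟩ with hv₂
  set v₇ : HeightOneSpectrum ℤ := (primesEquiv (R := ℤ)).symm ⟨7, by norm_num⟩ with hv₇
  have h2 : (primesEquiv v₂ : ℕ) = 2 := by rw [hv₂, Equiv.apply_symm_apply]
  have h7 : (primesEquiv v₇ : ℕ) = 7 := by rw [hv₇, Equiv.apply_symm_apply]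
  have hne : v₂ ≠ v₇ := by
    intro h; have := congrArg (fun v => (primesEquiv v : ℕ)) h; simp only [h2, h7] at this; omega
  have hprod := tamagawaProduct_eq_prod (⟨0, -42, 0, 448, 0⟩ : WeierstrassCurve ℚ) {v₂, v₇} (by
    intro v hv
    by_contra hmem
    apply hv
    rw [twoTorsionModel_neg_two_eq_baseChange]
    refine hasGoodReductionAt_of_not_dvd fun hdvd => hmem ?_
    rcases eq_two_or_seven_of_dvd_Δ_W3136 (prime_natGenerator v) hdvd with h | h
    · have : v = v₂ := by
        apply (primesEquiv (R := ℤ)).injective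
        exact Subtype.ext (by rw [h2]; exact h)
      simp [this]
    · have : v = v₇ := by
        apply (primesEquiv (R := ℤ)).injective
        exact Subtype.ext (by rw [h7]; exact h)
      simp [this])
  rw [Finset.prod_pair hne] at hprod
  haveI : Fact (Nat.Prime 2) := ⟨Nat.prime_two⟩
  haveI : Fact (Nat.Prime 7) := ⟨by norm_num⟩
  have c7 := localTamagawaNumber_padic_eq_of_forall_place (⟨0, -42, 0, 448, 0⟩ : WeierstrassCurve ℚ) v₇ 7 h7 2
    (fun w hw => localTamagawaNumber_W3136_seven w hw)
  have c2 := localTamagawaNumber_padic_eq_of_forall_place (⟨0, -42, 0, 448, 0⟩ : WeierstrassCurve ℚ) v₂ 2 h2 4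
    (fun w hw => localTamagawaNumber_W3136_two_eq_four w hw)
  rw [hprod, c2, c7]
  norm_num

/-- **«BSD₂(3136⁻) EXACT» BY NAME** (the C6 row of the F2 height-ratio chain of the genus Theorem A):
granted bsd.S31 (`bsdTriple_of_rank_le_one_of_conductor_lt`) and Modularity (`exists_isNewformOf`) ONLY,
the leading Taylor coefficient of `L(W₃₁₃₆, s)` at `s = 1` is `r · Ω(W₃₁₃₆) · ĥ(g₃₁₃₆)` with `r ∈ ℚ`,
`v₂(r) = 1` (`r = 2·#Ш/k²`: rank `1`, `Ш[2] = 0`, `#Ш` odd, `#E(ℚ)_tors = 2`, `Tam = 8`,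
`ĥ(g₃₁₃₆) = k²·Reg`, `k` odd, `N = 3136` — all kernel theorems of files II/III/V and §§1–4).
[cite: CreutzMiller2012, Thm 1.1 and the remark following it] [cite: CremonaAlgorithms1997, Table 1 (N = 3136)] -/
theorem leadingLCoeff_W3136 (hS31 : bsdTriple_of_rank_le_one_of_conductor_lt) (hmod : exists_isNewformOf) :
    ∃ r : ℚ, padicValRat 2 r = 1 ∧
      (⟨0, -42, 0, 448, 0⟩ : WeierstrassCurve ℚ).leadingLCoeff =
        ((r : ℝ) * (⟨0, -42, 0, 448, 0⟩ : WeierstrassCurve ℚ).realPeriodRat *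
          (Affine.Point.some 32 64 nonsingular_W3136_threeTwo_sixFour :
            (⟨0, -42, 0, 448, 0⟩ : WeierstrassCurve ℚ).toAffine.Point).canonicalHeight : ℝ) := by
  haveI := isElliptic_twoTorsionModel_neg_two
  obtain ⟨-, -, hodd, hlead⟩ := analyticRank_shaFinite_odd_twoTorsionModel_neg_two hS31 hmod
  obtain ⟨k, hk, hheight⟩ := exists_odd_canonicalHeight_threeTwoSixFour_W3136
  have htors := torsion_twoTorsionModel_neg_two.2
  have hkne : k ≠ 0 := fun h => by simp [h] at hk
  set S := (⟨0, -42, 0, 448, 0⟩ : WeierstrassCurve ℚ).shaOrder with hS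
  refine ⟨2 * (S : ℚ) / (k : ℚ) ^ 2, ?_, ?_⟩
  · -- `v₂(2 S / k²) = 1`
    have hS0 : (S : ℚ) ≠ 0 := by exact_mod_cast hodd.pos.ne'
    have hkq : (k : ℚ) ≠ 0 := by exact_mod_cast hkne
    haveI : Fact (Nat.Prime 2) := ⟨Nat.prime_two⟩
    have h22 : padicValRat 2 (2 : ℚ) = 1 := by simpa using padicValRat.self (p := 2) one_lt_two
    have h1 : padicValNat 2 S = 0 := padicValNat.eq_zero_of_not_dvd (fun h =>
      (Nat.not_even_iff_odd.mpr hodd) (even_iff_two_dvd.mpr h))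
    have h2 : padicValInt 2 k = 0 := by
      rw [padicValInt, padicValNat.eq_zero_of_not_dvd (fun h => ?_)]
      exact (Int.not_even_iff_odd.mpr hk)
        (even_iff_two_dvd.mpr (Int.natAbs_dvd_natAbs.mp (by simpa using h)))
    rw [padicValRat.div (mul_ne_zero two_ne_zero hS0) (pow_ne_zero 2 hkq),
      padicValRat.mul two_ne_zero hS0, padicValRat.pow, h22, padicValRat.of_nat, padicValRat.of_int,
      h1, h2]
    norm_num
  · have hreal : (⟨0, -42, 0, 448, 0⟩ : WeierstrassCurve ℚ).bsdRHS =
        ((2 * (S : ℚ) / (k : ℚ) ^ 2 : ℚ) : ℝ) * (⟨0, -42, 0, 448, 0⟩ : WeierstrassCurve ℚ).realPeriodRat *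
          (Affine.Point.some 32 64 nonsingular_W3136_threeTwo_sixFour :
            (⟨0, -42, 0, 448, 0⟩ : WeierstrassCurve ℚ).toAffine.Point).canonicalHeight := by
      rw [bsdRHS_def, tamagawaProduct_W3136, htors, hheight]
      push_cast
      field_simp
      ring
    rw [hlead, hreal]

end Summit.BirchSwinnertonDyer.BirchSwinnertonDyer.Theorems.GoldfeldGoodTwists

end
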